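import Literature.Analysis.Asymptotics.MonomialAmplitudeLaplace
import Mathlib.Topology.PartitionOfUnity
import Mathlib.Topology.UniformSpace.HeineCantor
import HarnessLib

/-!
# Monomial phase with an analytic (continuous, positive) unit

The chart-level form of the phase after resolution of singularities is `a(y) y^κ` with a
nonvanishing unit `a` (Lin 2017, Thm. 2.2 (iii); AGV II §7.3), not a pure monomial.  This file
removes the unit: for a continuous `a > 0`, a continuous amplitude `ψ ≥ 0` on the cube and the
cube weight `vol_w`,

  `∫_{a(x) x^κ ≤ t} ψ dvol_w / (t^λ (log 1/t)^{θ-1}) → c(ψ · a^{-λ})`   (`t → 0⁺`),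

where `c(·)` is the limit functional of `MonomialAmplitudeAsymptotics.lean` (`tendsto_unit_phase`):
the unit enters the leading coefficient as the amplitude factor `a^{-λ}` — exactly as in the
zeta-function formulation, where `(a y^κ)^{-z} φ = y^{-κz} (a^{-z} φ)` (Lin 2017, proof of
Lemma 2.4).  Proof: squeeze with a continuous partition of unity on which `a` is almost constant,
linearity and monotonicity of `c(·)`, and the scaling `N(γt)/N(t) → γ^λ`.

Everything is PROVED; no definitions, no named facts.

## References

* S. Lin, arXiv:1003.5338, Thm. 2.2 (iii), proof of Lemma 2.4. [Lin2017]
* V. I. Arnold, S. M. Gusein-Zade, A. N. Varchenko, *Singularities of Differentiable Maps II*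
  (2012), Part II §7.3 (reduction to elementary integrals). [ArnoldGuseinzadeVarchenko2012]
-/

noncomputable section

open MeasureTheory Filter Set Topology

open scoped ENNReal

namespace Literature.Analysis.Asymptotics.MonomialPhase

variable {d : ℕ} {κ : Fin d → ℕ} {w : Fin d → ℝ}

/-! ## Rescaling the level -/

/-- `t ↦ γ t` preserves `t → 0⁺`. [folklore] -/
theorem tendsto_const_mul_nhdsGT {γ : ℝ} (hγ : 0 < γ) :
    Tendsto (fun t : ℝ => γ * t) (𝓝[>] 0) (𝓝[>] 0) := by
  refine tendsto_nhdsWithin_of_tendsto_nhds_of_eventually_within _ ?_ ?_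
  · have h : Tendsto (fun t : ℝ => γ * t) (𝓝 0) (𝓝 (γ * 0)) := tendsto_const_nhds.mul tendsto_id
    rw [mul_zero] at h
    exact h.mono_left nhdsWithin_le_nhds
  · filter_upwards [self_mem_nhdsWithin] with t ht
    exact mul_pos hγ ht

/-- **Rescaling the level**: if `F(t)/(t^λ L^m) → c` (`L = log 1/t`) then
`F(γt)/(t^λ L^m) → c γ^λ` for `γ > 0`. [folklore] -/
theorem tendsto_comp_const_mul {F : ℝ → ℝ} {lam c γ : ℝ} {m : ℕ} (hγ : 0 < γ)
    (hF : Tendsto (fun t : ℝ => F t / (t ^ lam * Real.log t⁻¹ ^ m)) (𝓝[>] 0) (𝓝 c)) :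
    Tendsto (fun t : ℝ => F (γ * t) / (t ^ lam * Real.log t⁻¹ ^ m)) (𝓝[>] 0)
      (𝓝 (c * γ ^ lam)) := by
  have hlog : Tendsto (fun t : ℝ => Real.log t⁻¹) (𝓝[>] 0) atTop :=
    Real.tendsto_log_atTop.comp tendsto_inv_nhdsGT_zero
  have hmul := tendsto_const_mul_nhdsGT hγ
  have h1 := hF.comp hmul
  have h2 : Tendsto (fun t : ℝ => (Real.log (γ * t)⁻¹ / Real.log t⁻¹) ^ m) (𝓝[>] 0) (𝓝 1) := by
    have h3 : Tendsto (fun t : ℝ => 1 - Real.log γ / Real.log t⁻¹) (𝓝[>] 0) (𝓝 (1 - 0)) :=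
      tendsto_const_nhds.sub (tendsto_const_nhds.div_atTop hlog)
    rw [sub_zero] at h3
    have h4 : Tendsto (fun t : ℝ => Real.log (γ * t)⁻¹ / Real.log t⁻¹) (𝓝[>] 0) (𝓝 1) := by
      refine h3.congr' ?_
      filter_upwards [self_mem_nhdsWithin, hlog.eventually (eventually_gt_atTop 0)] with t
        (ht : 0 < t) hL
      rw [mul_inv, Real.log_mul (inv_ne_zero hγ.ne') (inv_ne_zero ht.ne'), Real.log_inv γ,
        neg_add_eq_sub, sub_div, div_self hL.ne']
    simpa using h4.pow m
  have h5 := (h1.mul h2).mul_const (γ ^ lam)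
  rw [mul_one] at h5
  refine h5.congr' ?_
  filter_upwards [self_mem_nhdsWithin, hlog.eventually (eventually_gt_atTop 0),
    hmul.eventually (hlog.eventually (eventually_gt_atTop 0))] with t (ht : 0 < t) hL hLγ
  simp only [Function.comp_apply] at hLγ ⊢
  rw [Real.mul_rpow hγ.le ht.le, div_pow]
  set L := Real.log t⁻¹ with hLdef
  set Lγ := Real.log (γ * t)⁻¹ with hLγdef
  have hta : 0 < t ^ lam := Real.rpow_pos_of_pos ht _
  have hγa : 0 < γ ^ lam := Real.rpow_pos_of_pos hγ _
  field_simp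

/-! ## Comparing integrals on sets nested on the support of the integrand -/

/-- If `g ≥ 0` a.e. and `A ⊆ B` on the support of `g` (a.e.), then `∫_A g ≤ ∫_B g`. [folklore] -/
theorem setIntegral_mono_of_subset_on_support {X : Type*} [MeasurableSpace X] {μ : Measure X}
    {g : X → ℝ} (hg : Integrable g μ) (hg0 : 0 ≤ᵐ[μ] g) {A B : Set X} (hA : MeasurableSet A)
    (hB : MeasurableSet B) (hAB : ∀ᵐ x ∂μ, x ∈ A → g x ≠ 0 → x ∈ B) :
    ∫ x in A, g x ∂μ ≤ ∫ x in B, g x ∂μ := by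
  rw [← integral_indicator hA, ← integral_indicator hB]
  refine integral_mono_ae (hg.indicator hA) (hg.indicator hB) ?_
  filter_upwards [hg0, hAB] with x hx hxAB
  by_cases hxA : x ∈ A
  · rw [indicator_of_mem hxA]
    by_cases hgx : g x = 0
    · rw [hgx]
      exact Set.indicator_nonneg (fun _ _ => hx) _
    · rw [indicator_of_mem (hxAB hxA hgx)]
  · rw [indicator_of_notMem hxA]
    exact Set.indicator_nonneg (fun _ _ => hx) _

/-! ## A partition of unity on which the unit is almost constant -/

/-- For a continuous positive `a` and `ε > 0` there is a finite continuous partition of unity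
`(χ_i)` on `[0,1]^d` with centres `p_i ∈ [0,1]^d` such that `a(x) ≤ (1+ε) a(p_i)` and
`a(p_i) ≤ (1+ε) a(x)` whenever `x ∈ [0,1]^d` and `χ_i(x) ≠ 0`. [folklore] -/
theorem exists_partition_unit (a : (Fin d → ℝ) → ℝ) (ha : Continuous a) (ha0 : ∀ x, 0 < a x)
    {ε : ℝ} (hε : 0 < ε) :
    ∃ (ι : Type) (_ : Fintype ι) (χ : ι → C((Fin d → ℝ), ℝ)) (p : ι → (Fin d → ℝ)),
      (∀ i x, 0 ≤ χ i x) ∧ (∀ x ∈ Icc (0 : Fin d → ℝ) 1, ∑ i, χ i x = 1) ∧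
      (∀ i, ∀ x ∈ Icc (0 : Fin d → ℝ) 1, χ i x ≠ 0 →
        a x ≤ (1 + ε) * a (p i) ∧ a (p i) ≤ (1 + ε) * a x) := by
  set K : Set (Fin d → ℝ) := Icc 0 1 with hK
  have hKc : IsCompact K := isCompact_Icc
  -- positive minimum of `a` on `K`
  obtain ⟨xm, hxm, hmin⟩ := hKc.exists_isMinOn ⟨0, by simp [hK]⟩ ha.continuousOn
  set m : ℝ := a xm with hm
  have hmpos : 0 < m := ha0 xm
  have hmle : ∀ x ∈ K, m ≤ a x := fun x hx => hmin hx
  -- uniform continuity of `a` on `K`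
  obtain ⟨δ, hδ, hδa⟩ := Metric.uniformContinuousOn_iff.1
    (hKc.uniformContinuousOn_of_continuous ha.continuousOn) (m * ε / 2) (by positivity)
  -- finite cover by `δ`-balls centred in `K` and a subordinate partition of unity
  obtain ⟨t, htK, hcover⟩ := hKc.elim_nhds_subcover (fun x => Metric.ball x δ)
    fun x _ => Metric.ball_mem_nhds x hδ
  obtain ⟨f, hf⟩ := PartitionOfUnity.exists_isSubordinate isClosed_Icc
    (fun i : ↥t => Metric.ball (i : Fin d → ℝ) δ) (fun i => Metric.isOpen_ball) (by
      intro x hx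
      obtain ⟨i, hi, hxi⟩ := mem_iUnion₂.1 (hcover hx)
      exact mem_iUnion.2 ⟨⟨i, hi⟩, hxi⟩)
  refine ⟨↥t, inferInstance, fun i => f i, fun i => (i : Fin d → ℝ), fun i x => f.nonneg i x,
    fun x hx => ?_, fun i x hx hne => ?_⟩
  · rw [← finsum_eq_sum_of_fintype]
    exact f.sum_eq_one hx
  · have hxi : x ∈ Metric.ball (i : Fin d → ℝ) δ :=
      hf i (subset_tsupport _ (Function.mem_support.2 hne))
    have hiK : (i : Fin d → ℝ) ∈ K := htK i i.2
    have hd : dist (a x) (a i) < m * ε / 2 := hδa x hx i hiK hxi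
    rw [Real.dist_eq, abs_lt] at hd
    have h1 := hmle x hx
    have h2 := hmle i hiK
    constructor <;> nlinarith

/-! ## The unit theorem -/

/-- **Monomial phase with a continuous positive unit** (chart form of the phase after resolution,
Lin 2017 Thm. 2.2 (iii)): if `a > 0` and `ψ` are continuous, `ψ ≥ 0` on `[0,1]^d`, and the
normalised sublevel integrals of the amplitude `ψ · a^{-λ}` for the pure monomial tend to `c`, then
`∫_{a(x) x^κ ≤ t} ψ dvol_w / (t^λ (log 1/t)^{θ-1}) → c` as well (`λ = rlct κ w`, `θ = rlctMult κ w`).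
[cite: Lin2017, Thm. 2.2 and proof of Lemma 2.4] -/
theorem tendsto_unit_phase (hκ : κ ≠ 0) (hw : ∀ j, 0 < w j) (ψ a : (Fin d → ℝ) → ℝ)
    (hψ : Continuous ψ) (hψ0 : ∀ x ∈ Icc (0 : Fin d → ℝ) 1, 0 ≤ ψ x) (ha : Continuous a)
    (ha0 : ∀ x, 0 < a x) {c : ℝ}
    (hc : Tendsto (fun t : ℝ =>
      (∫ x in {x : Fin d → ℝ | ∏ j, x j ^ κ j ≤ t}, ψ x * a x ^ (-rlct κ w)
          ∂(Measure.pi fun j => powMeasure (w j))) /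
        (t ^ rlct κ w * Real.log t⁻¹ ^ (rlctMult κ w - 1))) (𝓝[>] 0) (𝓝 c)) :
    Tendsto (fun t : ℝ =>
      (∫ x in {x : Fin d → ℝ | a x * ∏ j, x j ^ κ j ≤ t}, ψ x
          ∂(Measure.pi fun j => powMeasure (w j))) /
        (t ^ rlct κ w * Real.log t⁻¹ ^ (rlctMult κ w - 1))) (𝓝[>] 0) (𝓝 c) := by
  haveI := isFiniteMeasure_pi_powMeasure hw
  set μ : Measure (Fin d → ℝ) := Measure.pi fun j => powMeasure (w j) with hμ
  set lam := rlct κ w with hlam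
  set N : ℝ → ℝ := fun t => t ^ lam * Real.log t⁻¹ ^ (rlctMult κ w - 1) with hN
  have hlampos : 0 < lam := rlct_pos hκ hw
  have hlog : Tendsto (fun t : ℝ => Real.log t⁻¹) (𝓝[>] 0) atTop :=
    Real.tendsto_log_atTop.comp tendsto_inv_nhdsGT_zero
  have hNpos : ∀ᶠ t : ℝ in 𝓝[>] 0, 0 < N t := by
    filter_upwards [self_mem_nhdsWithin, hlog.eventually (eventually_gt_atTop 0)] with t
      (ht : 0 < t) hL
    exact mul_pos (Real.rpow_pos_of_pos ht _) (pow_pos hL _)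
  have hapow : Continuous fun x => a x ^ (-lam) :=
    ha.rpow_const fun x => Or.inl (ha0 x).ne'
  have hψa : Continuous fun x => ψ x * a x ^ (-lam) := hψ.mul hapow
  have hmeasA : ∀ t, MeasurableSet {x : Fin d → ℝ | a x * ∏ j, x j ^ κ j ≤ t} := fun t =>
    measurableSet_le (ha.measurable.mul (by fun_prop)) measurable_const
  have hcube := ae_mem_cube hw (d := d)
  have hprod0 : ∀ x ∈ Set.pi univ (fun _ : Fin d => Ioc (0 : ℝ) 1), 0 ≤ ∏ j, x j ^ κ j :=
    fun x hx => Finset.prod_nonneg fun j _ => pow_nonneg (hx j (mem_univ j)).1.le _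
  have hψχnn : ∀ (χ : C((Fin d → ℝ), ℝ)), (∀ x, 0 ≤ χ x) →
      0 ≤ᵐ[μ] fun x => ψ x * χ x := fun χ hχ =>
    hcube.mono fun x hx => mul_nonneg (hψ0 x (cube_subset_Icc hx)) (hχ x)
  -- `c ≥ 0`
  have hc0 : 0 ≤ c := by
    refine ge_of_tendsto hc ?_
    filter_upwards [hNpos] with t hNt
    refine div_nonneg (setIntegral_nonneg_of_ae_restrict (ae_restrict_of_ae ?_)) hNt.le
    exact hcube.mono fun x hx => mul_nonneg (hψ0 x (cube_subset_Icc hx))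
      (Real.rpow_nonneg (ha0 x).le _)
  -- ### the squeeze, for a fixed `ε > 0`
  have key : ∀ ε : ℝ, 0 < ε → ∃ Slow Sup : ℝ,
      c / ((1 + ε) ^ lam) ^ 2 ≤ Slow ∧ Sup ≤ c * ((1 + ε) ^ lam) ^ 2 ∧
      (∀ b < Slow, ∀ᶠ t : ℝ in 𝓝[>] 0,
        b < (∫ x in {x : Fin d → ℝ | a x * ∏ j, x j ^ κ j ≤ t}, ψ x ∂μ) / N t) ∧
      (∀ b > Sup, ∀ᶠ t : ℝ in 𝓝[>] 0,
        (∫ x in {x : Fin d → ℝ | a x * ∏ j, x j ^ κ j ≤ t}, ψ x ∂μ) / N t < b) := by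
    intro ε hε
    obtain ⟨ι, _, χ, p, hχ0, hχ1, hχa⟩ := exists_partition_unit a ha ha0 hε
    set A : ℝ := 1 + ε with hA
    have hApos : 0 < A := by linarith
    have hqpos : 0 < A ^ lam := Real.rpow_pos_of_pos hApos _
    have hapi : ∀ i, 0 < a (p i) := fun i => ha0 _
    -- the pieces and their limits
    have hcont : ∀ i, Continuous fun x => ψ x * χ i x := fun i => hψ.mul (χ i).continuous
    have hconta : ∀ i, Continuous fun x => ψ x * χ i x * a x ^ (-lam) :=
      fun i => (hcont i).mul hapow
    choose cW hcW using fun i => tendsto_amplitude hκ hw (fun x => ψ x * χ i x) (hcont i)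
    choose c' hc' using fun i => tendsto_amplitude hκ hw (fun x => ψ x * χ i x * a x ^ (-lam))
      (hconta i)
    have hint : ∀ i, Integrable (fun x => ψ x * χ i x) μ :=
      fun i => integrable_of_continuous hw (hcont i)
    have hinta : ∀ i, Integrable (fun x => ψ x * χ i x * a x ^ (-lam)) μ :=
      fun i => integrable_of_continuous hw (hconta i)
    -- `∑ c'_i = c`
    have hsumc' : ∑ i, c' i = c := by
      refine tendsto_nhds_unique (tendsto_finsetSum Finset.univ fun i _ => hc' i) ?_
      refine hc.congr' (Eventually.of_forall fun t => ?_)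
      dsimp only
      rw [← Finset.sum_div]
      congr 1
      rw [← integral_finsetSum _ fun i _ => (hinta i).integrableOn]
      refine integral_congr_ae (ae_restrict_of_ae (hcube.mono fun x hx => ?_))
      dsimp only
      simp_rw [mul_right_comm (ψ x) _ (a x ^ (-lam))]
      rw [← Finset.mul_sum, hχ1 x (cube_subset_Icc hx), mul_one]
    -- bounds on `c'_i` from monotonicity in the amplitude
    have hc'up : ∀ i, c' i ≤ cW i * (a (p i) ^ (-lam) * (A ^ lam)) := by
      intro i
      have hlim : Tendsto (fun t : ℝ => (∫ x in {x : Fin d → ℝ | ∏ j, x j ^ κ j ≤ t},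
          (fun x => ψ x * χ i x * (a (p i) ^ (-lam) * (A ^ lam))) x ∂μ) / N t) (𝓝[>] 0)
          (𝓝 (cW i * (a (p i) ^ (-lam) * (A ^ lam)))) := by
        refine ((hcW i).mul_const _).congr' (Eventually.of_forall fun t => ?_)
        dsimp only
        rw [integral_mul_const]
        ring
      refine amplitude_limit_mono hw (hconta i) ((hcont i).mul continuous_const) ?_ (hc' i) hlim
      intro x hx
      by_cases hχx : χ i x = 0
      · simp [hχx]
      · have hψχ : 0 ≤ ψ x * χ i x := mul_nonneg (hψ0 x hx) (hχ0 i x)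
        refine mul_le_mul_of_nonneg_left ?_ hψχ
        -- `a x ^ (-lam) ≤ a(p i)^(-lam) (A ^ lam)` from `a (p i) ≤ A * a x`
        have h1 : a (p i) ≤ A * a x := (hχa i x hx hχx).2
        calc a x ^ (-lam) = (A * a x) ^ (-lam) * A ^ lam := by
              rw [Real.mul_rpow hApos.le (ha0 x).le, Real.rpow_neg hApos.le]
              field_simp
          _ ≤ a (p i) ^ (-lam) * A ^ lam :=
              mul_le_mul_of_nonneg_right (Real.rpow_le_rpow_of_nonpos (hapi i) h1
                (by linarith)) hqpos.le
    have hc'low : ∀ i, cW i * (a (p i) ^ (-lam) / (A ^ lam)) ≤ c' i := by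
      intro i
      have hlim : Tendsto (fun t : ℝ => (∫ x in {x : Fin d → ℝ | ∏ j, x j ^ κ j ≤ t},
          (fun x => ψ x * χ i x * (a (p i) ^ (-lam) / (A ^ lam))) x ∂μ) / N t) (𝓝[>] 0)
          (𝓝 (cW i * (a (p i) ^ (-lam) / (A ^ lam)))) := by
        refine ((hcW i).mul_const _).congr' (Eventually.of_forall fun t => ?_)
        dsimp only
        rw [integral_mul_const]
        ring
      refine amplitude_limit_mono hw ((hcont i).mul continuous_const) (hconta i) ?_ hlim (hc' i)
      intro x hx
      by_cases hχx : χ i x = 0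
      · simp [hχx]
      · have hψχ : 0 ≤ ψ x * χ i x := mul_nonneg (hψ0 x hx) (hχ0 i x)
        refine mul_le_mul_of_nonneg_left ?_ hψχ
        have h1 : a x ≤ A * a (p i) := (hχa i x hx hχx).1
        calc a (p i) ^ (-lam) / (A ^ lam) = (A * a (p i)) ^ (-lam) := by
              rw [Real.mul_rpow hApos.le (hapi i).le, Real.rpow_neg hApos.le]
              field_simp
          _ ≤ a x ^ (-lam) := Real.rpow_le_rpow_of_nonpos (ha0 x) h1 (by linarith)
    -- the amplitude integrals split along the partition
    have hsplit : ∀ t, ∫ x in {x : Fin d → ℝ | a x * ∏ j, x j ^ κ j ≤ t}, ψ x ∂μ =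
        ∑ i, ∫ x in {x : Fin d → ℝ | a x * ∏ j, x j ^ κ j ≤ t}, ψ x * χ i x ∂μ := by
      intro t
      rw [← integral_finsetSum _ fun i _ => (hint i).integrableOn]
      refine integral_congr_ae (ae_restrict_of_ae (hcube.mono fun x hx => ?_))
      dsimp only
      rw [← Finset.mul_sum, hχ1 x (cube_subset_Icc hx), mul_one]
    -- sandwich inequalities
    have hlowineq : ∀ t, 0 < t → ∀ i,
        ∫ x in {x : Fin d → ℝ | ∏ j, x j ^ κ j ≤ (A * a (p i))⁻¹ * t}, ψ x * χ i x ∂μ ≤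
          ∫ x in {x : Fin d → ℝ | a x * ∏ j, x j ^ κ j ≤ t}, ψ x * χ i x ∂μ := by
      intro t ht i
      refine setIntegral_mono_of_subset_on_support (hint i) (hψχnn (χ i) (hχ0 i))
        (measurableSet_sublevel κ _) (hmeasA t) (hcube.mono fun x hx hxA hne => ?_)
      have hχx : χ i x ≠ 0 := fun h => hne (by rw [h, mul_zero])
      have h1 : a x ≤ A * a (p i) := (hχa i x (cube_subset_Icc hx) hχx).1
      have h0 := hprod0 x hx
      simp only [mem_setOf_eq] at hxA ⊢
      have hAa : 0 < A * a (p i) := mul_pos hApos (hapi i)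
      calc a x * ∏ j, x j ^ κ j ≤ (A * a (p i)) * ((A * a (p i))⁻¹ * t) :=
            mul_le_mul h1 hxA h0 hAa.le
        _ = t := by rw [← mul_assoc, mul_inv_cancel₀ hAa.ne', one_mul]
    have hupineq : ∀ t, 0 < t → ∀ i,
        ∫ x in {x : Fin d → ℝ | a x * ∏ j, x j ^ κ j ≤ t}, ψ x * χ i x ∂μ ≤
          ∫ x in {x : Fin d → ℝ | ∏ j, x j ^ κ j ≤ A / a (p i) * t}, ψ x * χ i x ∂μ := by
      intro t ht i
      refine setIntegral_mono_of_subset_on_support (hint i) (hψχnn (χ i) (hχ0 i))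
        (hmeasA t) (measurableSet_sublevel κ _) (hcube.mono fun x hx hxB hne => ?_)
      have hχx : χ i x ≠ 0 := fun h => hne (by rw [h, mul_zero])
      have h1 : a (p i) ≤ A * a x := (hχa i x (cube_subset_Icc hx) hχx).2
      have h0 := hprod0 x hx
      simp only [mem_setOf_eq] at hxB ⊢
      rw [div_mul_eq_mul_div, le_div_iff₀ (hapi i)]
      calc (∏ j, x j ^ κ j) * a (p i) = a (p i) * ∏ j, x j ^ κ j := mul_comm _ _
        _ ≤ (A * a x) * ∏ j, x j ^ κ j := mul_le_mul_of_nonneg_right h1 h0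
        _ = A * (a x * ∏ j, x j ^ κ j) := by ring
        _ ≤ A * t := mul_le_mul_of_nonneg_left hxB hApos.le
    -- the two comparison functions and their limits
    have hΦlow : Tendsto (fun t : ℝ => (∑ i, ∫ x in {x : Fin d → ℝ | ∏ j, x j ^ κ j ≤
        (A * a (p i))⁻¹ * t}, ψ x * χ i x ∂μ) / N t) (𝓝[>] 0)
        (𝓝 (∑ i, cW i * ((A * a (p i))⁻¹) ^ lam)) := by
      have h := tendsto_finsetSum Finset.univ fun i _ =>
        tendsto_comp_const_mul (F := fun s => ∫ x in {x : Fin d → ℝ | ∏ j, x j ^ κ j ≤ s},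
          ψ x * χ i x ∂μ) (inv_pos.2 (mul_pos hApos (hapi i))) (hcW i)
      refine h.congr' (Eventually.of_forall fun t => ?_)
      simp only [hN, hlam, Finset.sum_div]
    have hΦup : Tendsto (fun t : ℝ => (∑ i, ∫ x in {x : Fin d → ℝ | ∏ j, x j ^ κ j ≤
        A / a (p i) * t}, ψ x * χ i x ∂μ) / N t) (𝓝[>] 0)
        (𝓝 (∑ i, cW i * (A / a (p i)) ^ lam)) := by
      have h := tendsto_finsetSum Finset.univ fun i _ =>
        tendsto_comp_const_mul (F := fun s => ∫ x in {x : Fin d → ℝ | ∏ j, x j ^ κ j ≤ s},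
          ψ x * χ i x ∂μ) (div_pos hApos (hapi i)) (hcW i)
      refine h.congr' (Eventually.of_forall fun t => ?_)
      simp only [hN, hlam, Finset.sum_div]
    refine ⟨∑ i, cW i * ((A * a (p i))⁻¹) ^ lam, ∑ i, cW i * (A / a (p i)) ^ lam, ?_, ?_, ?_, ?_⟩
    · -- `c / (A ^ lam)² ≤ Slow`
      rw [← hsumc', Finset.sum_div]
      refine Finset.sum_le_sum fun i _ => ?_
      have h1 := hc'up i
      have hid : ((A * a (p i))⁻¹) ^ lam = a (p i) ^ (-lam) / (A ^ lam) := by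
        rw [Real.inv_rpow (mul_pos hApos (hapi i)).le, Real.mul_rpow hApos.le (hapi i).le,
          Real.rpow_neg (hapi i).le]
        field_simp
      rw [hid]
      rw [div_le_iff₀ (by positivity)]
      calc c' i ≤ cW i * (a (p i) ^ (-lam) * (A ^ lam)) := h1
        _ = cW i * (a (p i) ^ (-lam) / (A ^ lam)) * (A ^ lam) ^ 2 := by
            field_simp
    · -- `Sup ≤ c (A ^ lam)²`
      rw [← hsumc', Finset.sum_mul]
      refine Finset.sum_le_sum fun i _ => ?_
      have h1 := hc'low i
      have hid : (A / a (p i)) ^ lam = a (p i) ^ (-lam) * (A ^ lam) := by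
        rw [Real.div_rpow hApos.le (hapi i).le, Real.rpow_neg (hapi i).le]
        field_simp
      rw [hid]
      rw [← mul_div_assoc, div_le_iff₀ hqpos] at h1
      calc cW i * (a (p i) ^ (-lam) * (A ^ lam)) = cW i * a (p i) ^ (-lam) * (A ^ lam) := by ring
        _ ≤ c' i * (A ^ lam) * (A ^ lam) := mul_le_mul_of_nonneg_right h1 hqpos.le
        _ = c' i * (A ^ lam) ^ 2 := by ring
    · intro b hb
      filter_upwards [hΦlow.eventually (lt_mem_nhds hb), hNpos, self_mem_nhdsWithin] with t ht
        hNt (htpos : 0 < t)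
      refine ht.trans_le (div_le_div_of_nonneg_right ?_ hNt.le)
      rw [hsplit t]
      exact Finset.sum_le_sum fun i _ => hlowineq t htpos i
    · intro b hb
      filter_upwards [hΦup.eventually (gt_mem_nhds hb), hNpos, self_mem_nhdsWithin] with t ht
        hNt (htpos : 0 < t)
      refine lt_of_le_of_lt (div_le_div_of_nonneg_right ?_ hNt.le) ht
      rw [hsplit t]
      exact Finset.sum_le_sum fun i _ => hupineq t htpos i
  -- ### choice of `ε` and conclusion
  have hq1 : Tendsto (fun ε : ℝ => (1 + ε) ^ lam) (𝓝[>] 0) (𝓝 1) := by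
    have h : ContinuousAt (fun ε : ℝ => (1 + ε) ^ lam) 0 :=
      ((continuous_const.add continuous_id).rpow_const fun _ => Or.inr hlampos.le).continuousAt
    have h' := h.tendsto
    simp only [add_zero, Real.one_rpow] at h'
    exact h'.mono_left nhdsWithin_le_nhds
  have hq2 : Tendsto (fun ε : ℝ => ((1 + ε) ^ lam) ^ 2) (𝓝[>] 0) (𝓝 1) := by
    simpa using hq1.pow 2
  rw [tendsto_order]
  constructor
  · intro b hb
    have hlim : Tendsto (fun ε : ℝ => c / ((1 + ε) ^ lam) ^ 2) (𝓝[>] 0) (𝓝 c) := by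
      have h := (tendsto_const_nhds (x := c) (f := 𝓝[>] (0 : ℝ))).div hq2 one_ne_zero
      rw [div_one] at h
      exact h
    obtain ⟨ε, hbε, hε⟩ := ((hlim.eventually (lt_mem_nhds hb)).and self_mem_nhdsWithin).exists
    obtain ⟨Slow, Sup, hlow, -, hevl, -⟩ := key ε hε
    exact hevl b (hbε.trans_le hlow)
  · intro b hb
    have hlim : Tendsto (fun ε : ℝ => c * ((1 + ε) ^ lam) ^ 2) (𝓝[>] 0) (𝓝 c) := by
      have h := (tendsto_const_nhds (x := c) (f := 𝓝[>] (0 : ℝ))).mul hq2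
      rw [mul_one] at h
      exact h
    obtain ⟨ε, hbε, hε⟩ := ((hlim.eventually (gt_mem_nhds hb)).and self_mem_nhdsWithin).exists
    obtain ⟨Slow, Sup, -, hup, -, hevu⟩ := key ε hε
    exact hevu b (lt_of_le_of_lt hup hbε)

/-- **Monomial phase with unit, positive amplitude at the origin**: for continuous `a > 0` and
`ψ ≥ 0` on `[0,1]^d` with `ψ(0) > 0`,
`∫_{a(x) x^κ ≤ t} ψ dvol_w / (t^λ (log 1/t)^{θ-1}) → c > 0`. This is the chart-level input of
the gluing argument (Lin 2017, proof of Lemma 2.4: every chart piece has an amplitude positive at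
its centre). [cite: Lin2017, Prop. 2.1, Thm. 2.2, Lemma 2.4] -/
theorem exists_tendsto_unit_phase_pos (hκ : κ ≠ 0) (hw : ∀ j, 0 < w j)
    (ψ a : (Fin d → ℝ) → ℝ) (hψ : Continuous ψ) (hψ0 : ∀ x ∈ Icc (0 : Fin d → ℝ) 1, 0 ≤ ψ x)
    (hψpos : 0 < ψ 0) (ha : Continuous a) (ha0 : ∀ x, 0 < a x) :
    ∃ c : ℝ, 0 < c ∧ Tendsto (fun t : ℝ =>
      (∫ x in {x : Fin d → ℝ | a x * ∏ j, x j ^ κ j ≤ t}, ψ x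
          ∂(Measure.pi fun j => powMeasure (w j))) /
        (t ^ rlct κ w * Real.log t⁻¹ ^ (rlctMult κ w - 1))) (𝓝[>] 0) (𝓝 c) := by
  have hapow : Continuous fun x => a x ^ (-rlct κ w) :=
    ha.rpow_const fun x => Or.inl (ha0 x).ne'
  obtain ⟨c, hc, hlim⟩ := tendsto_amplitude_pos hκ hw (fun x => ψ x * a x ^ (-rlct κ w))
    (hψ.mul hapow) (fun x hx => mul_nonneg (hψ0 x hx) (Real.rpow_nonneg (ha0 x).le _))
    (mul_pos hψpos (Real.rpow_pos_of_pos (ha0 0) _))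
  exact ⟨c, hc, tendsto_unit_phase hκ hw ψ a hψ hψ0 ha ha0 hlim⟩

end Literature.Analysis.Asymptotics.MonomialPhase

end
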